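import Summits.Ventures.PercRepro.S1CoreCapSixThree
import Summits.Ventures.PercRepro.S1CoreCapSixTwoFourSimple
import Summits.Ventures.PercRepro.S1CoreCapSixTwoHeavy
import Summits.Ventures.PercRepro.S1CoreCapSixOneFinal
import Summits.Ventures.PercRepro.S1CoreCapSixZeroHeavy

/-!
# PercRepro — THE INSTANCE `ν = 6` OF THE 4-CIRCUIT-CAP SPEC, PROVED: `Q*(6) = 16` (p1, gen 25)

`fourCapSpec_six : FourCapSpec capPaper 6 16`. By the number of lines of `≥ 4` points: four cost `2 + 2 + 2 + 1`
(`not_four_big`); three are simple 4-point lines with at most four transversals (`S1CoreCapSixThree`); two are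
either simple 4-point lines with `≤ 8` further lines (`S1CoreCapSixTwoFour`, `S1CoreCapSixTwoFourSimple`) or
carry a weight-5 line with `≤ 3` further chords (`S1CoreCapSixTwoHeavy`); one big line leaves the budget
`8 − |A| − fat A` on free lines and new fat points (`S1CoreCapSixOne`, `…OneCases`, `…OneFinal`); no big line is the
thin case of `S1CoreCapSpecFiveThin` at budget `6` or a 3-point line with two fat points (`S1CoreCapSixZero`,
`…ZeroHeavy`). The bound is attained by three 4-point lines forming a triangle with the four transversals
avoiding its vertices (cap `4 + 4 + 4 + 1 + 1 + 1 + 1`), the searches' extremal configuration.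
`proofs/P1-S4-CAPBRIDGE.md` §17. Axioms: standard.
-/

namespace PercRepro

namespace S1

namespace FourCap

variable {β : Type} [DecidableEq β]

section SixCases

variable {w : β → ℕ} {ls : Finset (Finset β)}
  (h1 : ∀ L ∈ ls, ∀ v ∈ L, w v = 1 ∨ w v = 2)
  (h2 : ∀ L ∈ ls, 3 ≤ L.card ∧ wsum w L ≤ 5)
  (h3 : ∀ L ∈ ls, ∀ L' ∈ ls, L ≠ L' → (L ∩ L').card ≤ 1)
  (h4 : ∀ l : List (Finset β), l.Nodup → (∀ L ∈ l, L ∈ ls) → wsum w (unionL l) ≤ 6 + lineRank l)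

include h1 h2 h3 h4 in
/-- **Four big lines are impossible**: the ordering costs at least `2 + 2 + 2 + 1`. -/
theorem not_four_big {L₁ L₂ L₃ L₄ : Finset β} (hL₁ : L₁ ∈ ls) (hL₂ : L₂ ∈ ls) (hL₃ : L₃ ∈ ls) (hL₄ : L₄ ∈ ls)
    (h12 : L₂ ≠ L₁) (h13 : L₃ ≠ L₁) (h14 : L₄ ≠ L₁) (h23 : L₃ ≠ L₂) (h24 : L₄ ≠ L₂) (h34 : L₄ ≠ L₃)
    (c1 : 4 ≤ L₁.card) (c2 : 4 ≤ L₂.card) (c3 : 4 ≤ L₃.card) (c4 : 4 ≤ L₄.card) : False := by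
  have hc := costSum_le h1 (two_le_card_of_spec h2) h4 [L₄, L₃, L₂, L₁]
    (by simp [h12, h13, h14, h23, h24, h34]) (by simp [hL₁, hL₂, hL₃, hL₄])
  simp only [costSum, unionL, Finset.union_empty, Nat.zero_add] at hc
  have e1 := lineCost_empty w L₁
  have e2 := lineCost_of_inter_le_two (w := w) (le_trans (h3 L₂ hL₂ L₁ hL₁ h12) (by omega))
  have e3 := lineCost_of_inter_le_two (w := w) (le_trans (card_inter_union_le L₃ L₂ L₁)
    (by have := h3 L₃ hL₃ L₂ hL₂ h23; have := h3 L₃ hL₃ L₁ hL₁ h13; omega))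
  have e4 := lineCost_ge (w := w) L₄ (L₃ ∪ (L₂ ∪ L₁))
  have i4 : (L₄ ∩ (L₃ ∪ (L₂ ∪ L₁))).card ≤ 3 := le_trans (card_inter_union_le L₄ L₃ (L₂ ∪ L₁))
    (le_trans (Nat.add_le_add_left (card_inter_union_le L₄ L₂ L₁) _)
      (by have := h3 L₄ hL₄ L₃ hL₃ h34; have := h3 L₄ hL₄ L₂ hL₂ h24; have := h3 L₄ hL₄ L₁ hL₁ h14; omega))
  omega

include h1 h2 h3 h4 in
/-- **Every configuration of the spec at nullity `6` has cap sum `≤ 16`**, by the number of lines of `≥ 4` points. -/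
theorem sum_cap_le_sixteen : ∑ L ∈ ls, capPaper L.card (fat w L) ≤ 16 := by
  set F := ls.filter (fun L => 4 ≤ L.card) with hF
  have hFmem : ∀ L ∈ F, L ∈ ls ∧ 4 ≤ L.card := fun L hL => Finset.mem_filter.1 hL
  have hcard3 : ∀ L ∈ ls, L ∉ F → L.card = 3 := by
    intro L hL hLF
    have := (h2 L hL).1
    by_contra hne
    exact hLF (Finset.mem_filter.2 ⟨hL, by omega⟩)
  rcases (by omega : F.card = 0 ∨ F.card = 1 ∨ F.card = 2 ∨ F.card = 3 ∨ 3 < F.card)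
    with h0 | hone | htwo | hthree | hfour
  · -- no big line
    refine sum_cap_le_sixteen_of_no_big h1 h2 h3 h4 (fun L hL => hcard3 L hL ?_)
    rw [Finset.card_eq_zero.1 h0]
    exact Finset.notMem_empty L
  · -- one big line
    obtain ⟨A, hA⟩ := Finset.card_eq_one.1 hone
    have hAF : A ∈ F := hA ▸ Finset.mem_singleton_self A
    exact sum_cap_le_sixteen_of_one_big h1 h2 h3 h4 (hFmem A hAF).1 (hFmem A hAF).2
      (fun L hL hne => hcard3 L hL (by rw [hA]; exact fun h => hne (Finset.mem_singleton.1 h)))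
  · -- two big lines
    obtain ⟨A, B, hne, hF2⟩ := Finset.card_eq_two.1 htwo
    have hAF : A ∈ F := hF2 ▸ Finset.mem_insert_self A {B}
    have hBF : B ∈ F := hF2 ▸ Finset.mem_insert_of_mem (Finset.mem_singleton_self B)
    obtain ⟨hA, cA⟩ := hFmem A hAF
    obtain ⟨hB, cB⟩ := hFmem B hBF
    have hrest : ∀ L ∈ ls, L ≠ A → L ≠ B → L.card = 3 := fun L hL hLA hLB => hcard3 L hL (by
      rw [hF2]
      simp [hLA, hLB])
    by_cases hw : wsum w A ≤ 4 ∧ wsum w B ≤ 4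
    · have cA' : A.card = 4 := le_antisymm (le_trans (card_le_wsum w A (h1 A hA)) hw.1) cA
      have cB' : B.card = 4 := le_antisymm (le_trans (card_le_wsum w B (h1 B hB)) hw.2) cB
      exact sum_cap_le_sixteen_of_two_four h1 h2 h3 h4 hA hB hne.symm cA' cB'
        (simple_of_card_four (h1 A hA) hw.1 cA').1 (simple_of_card_four (h1 B hB) hw.2 cB').1 hrest
    · rcases (by
          have := (h2 A hA).2
          have := (h2 B hB).2
          omega : wsum w A = 5 ∨ wsum w B = 5) with wA | wB
      · exact sum_cap_le_sixteen_of_two_heavy h1 h2 h3 h4 hA hB hne.symm cA cB wA hrest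
      · exact sum_cap_le_sixteen_of_two_heavy h1 h2 h3 h4 hB hA hne cB cA wB
          (fun L hL hLB hLA => hrest L hL hLA hLB)
  · -- three big lines
    obtain ⟨L₁, L₂, L₃, h12, h13, h23, hF3⟩ := Finset.card_eq_three.1 hthree
    have hL₁F : L₁ ∈ F := hF3 ▸ Finset.mem_insert_self L₁ {L₂, L₃}
    have hL₂F : L₂ ∈ F := hF3 ▸ Finset.mem_insert_of_mem (Finset.mem_insert_self L₂ {L₃})
    have hL₃F : L₃ ∈ F := hF3 ▸ Finset.mem_insert_of_mem (Finset.mem_insert_of_mem (Finset.mem_singleton_self L₃))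
    exact sum_cap_le_sixteen_of_three_big h1 h2 h3 h4 (hFmem L₁ hL₁F).1 (hFmem L₂ hL₂F).1 (hFmem L₃ hL₃F).1
      h12.symm h13.symm h23.symm (hFmem L₁ hL₁F).2 (hFmem L₂ hL₂F).2 (hFmem L₃ hL₃F).2
  · -- four big lines: impossible
    exfalso
    obtain ⟨L₁, hL₁, L₂, hL₂, L₃, hL₃, h12, h13, h23⟩ := Finset.two_lt_card.1 (by omega : 2 < F.card)
    obtain ⟨L₄, hL₄, hL₄'⟩ : ∃ L₄ ∈ F, L₄ ∉ ({L₁, L₂, L₃} : Finset (Finset β)) := by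
      by_contra hc
      have hsub : F ⊆ {L₁, L₂, L₃} := fun L hL => by
        by_contra h
        exact hc ⟨L, hL, h⟩
      have := Finset.card_le_card hsub
      rw [Finset.card_insert_of_notMem (by simp [h12, h13]), Finset.card_pair h23] at this
      omega
    simp only [Finset.mem_insert, Finset.mem_singleton, not_or] at hL₄'
    exact not_four_big h1 h2 h3 h4 (hFmem L₁ hL₁).1 (hFmem L₂ hL₂).1 (hFmem L₃ hL₃).1 (hFmem L₄ hL₄).1
      h12.symm h13.symm hL₄'.1 h23.symm hL₄'.2.1 hL₄'.2.2 (hFmem L₁ hL₁).2 (hFmem L₂ hL₂).2 (hFmem L₃ hL₃).2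
      (hFmem L₄ hL₄).2

end SixCases

/-- **THE INSTANCE `ν = 6`, PROVED**: `FourCapSpec capPaper 6 16` — the searches' `Q*(6) = 16` is a theorem. -/
theorem fourCapSpec_six : FourCapSpec capPaper 6 16 := by
  intro β _ w ls h1 h2 h3 h4 _ _
  exact sum_cap_le_sixteen h1 h2 h3 h4

end FourCap

end S1

end PercRepro
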